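import Literature.Barriers.RiemannHypothesis.DavenportHeilbronnDegreeTwo
import Literature.NumberTheory.EllipticCurves.CuspFormLFunctionProofs
import Literature.NumberTheory.EllipticCurves.NewformsHeckeProofs
import Literature.NumberTheory.EllipticCurves.ModularCurveProofs
import Literature.NumberTheory.LFunctions.SaiasWeingartner
import Mathlib.NumberTheory.LSeries.Linearity
import HarnessLib

/-!
# Booker–Thorne at level one, step B: `Λ_f` versus the `L`-series of the eigenform combination

Sibling of `DavenportHeilbronnDegreeTwo.lean` (barrier catalogue, D-0021); everything here is
PROVED, there are no definitions and no named facts. Second step of the proof of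
`Literature.Barriers.RiemannHypothesis.BookerThorne2014_levelOne_zeros` (Booker–Thorne 2014,
Thm. 1 with §1 Remark 2 at level `N = 1`): the zeros of the complete `L`-function
`Λ_f(s) = ∫_0^∞ f(iy) y^{s-1} dy` (`cuspFormLambda`) in the half-plane `Re s > (k+1)/2` are the
zeros of the Dirichlet series `L(f, s) = ∑ a_n n^{-s}`, and for a combination `f = ∑_g c_g g`
of cusp forms they are the zeros of `∑_g c_g L(g, s)` — the function
`P(L(s, π_1), …, L(s, π_n))` of Booker–Thorne's Theorem 2 with `P = ∑ c_g x_g` linear, up to the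
real shift `s ↦ s + (k-1)/2` (§1: Theorem 1 "as a corollary of" Theorem 2; "the `Γ`-factor and
`(2π)^{-s}` having no zeros").

* `cuspCoeff_sum_smul`, `cuspFormLSeries_sum_smul` — linearity of `q`-expansion coefficients and
  of `L(·, s)` on `Re s > (k+1)/2` (absolute convergence there is the tree's unconditional
  `LSeriesSummable_cuspCoeff_of_lt_re`, Rankin's mean-square bound);
* `mellin_imagAxis_eq_of_lt_re` — `∫_0^∞ f(it) t^{s-1} dt = (2π)^{-s} Γ(s) L(f, s)` on
  `Re s > (k+1)/2`, `Re s > 0` (tree: `heckeContinuation_eq_cuspFormLSeries_of_lt_re`);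
* `cuspFormLambda_eq`, `cuspFormLambda_eq_zero_iff_sum` — for `f : CuspForm 𝒮ℒ k` written as
  `⇑(∑_g c_g g) = ⇑f` with `g : CuspForm (Gamma0 1) k`:
  `Λ_f(s) = 0 ↔ ∑_g c_g L(g, s) = 0` on `Re s > (k+1)/2`;
* `twelve_le_weight_of_ne_zero` — a non-zero level-one cusp form has weight `k ≥ 12` (Mathlib's
  dimension formula), so that `Re s > (k+1)/2` implies `Re s > 0`;
* `levelOne_zeros_of_hasLinearlyManyZeros` — the counting conclusion of
  `BookerThorne2014_levelOne_zeros` for `Λ_f` follows from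
  `HasLinearlyManyZeros (∑_g c_g L(g, ·)) σ₁ σ₂` (the tree's Saias–Weingartner counting predicate).

## References

* [BookerThorne2014] A. R. Booker, F. Thorne, *Zeros of L-functions outside the critical strip*,
  Algebra Number Theory 8 (2014), 2027–2042, Thm. 1, §1 (Thm. 1 from Thm. 2), §4.
* [DiamondShurman2005] F. Diamond, J. Shurman, *A First Course in Modular Forms*, §5.9–5.10.
-/

noncomputable section

open UpperHalfPlane CongruenceSubgroup
open scoped MatrixGroups ModularForm
open Literature.NumberTheory.EllipticCurves.ModularForms
open Literature.NumberTheory.LFunctions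

namespace Literature.Barriers.RiemannHypothesis

/-! ### Linearity of coefficients and `L`-series -/

/-- `a_n(∑_g c_g g) = ∑_g c_g a_n(g)` for cusp forms on `Γ₀(N)` (period-`1` `q`-expansions are
additive and homogeneous, Mathlib `ModularForm.qExpansion_add`/`qExpansion_smul`). [folklore] -/
theorem cuspCoeff_sum_smul {N : ℕ} [NeZero N] {k : ℤ} {ι : Type*} (S : Finset ι)
    (g : ι → CuspForm (Gamma0 N) k) (c : ι → ℂ) (n : ℕ) :
    cuspCoeff (∑ i ∈ S, c i • g i) n = ∑ i ∈ S, c i * cuspCoeff (g i) n := by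
  classical
  induction S using Finset.induction_on with
  | empty =>
    simp only [Finset.sum_empty, cuspCoeff]
    rw [CuspForm.coe_zero, qExpansion_zero]
    simp
  | insert a S ha ih =>
    rw [Finset.sum_insert ha, Finset.sum_insert ha, ← ih]
    simp only [cuspCoeff]
    rw [CuspForm.coe_add, ModularForm.qExpansion_add one_pos (one_mem_strictPeriods_gamma0 N)
      (c a • g a) (∑ i ∈ S, c i • g i), map_add, qExpansion_coeff_smul]

/-- **`L(∑_g c_g g, s) = ∑_g c_g L(g, s)` on `Re s > (k+1)/2`**, where every `L(g, s)` converges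
absolutely (Rankin; tree `LSeriesSummable_cuspCoeff_of_lt_re`). [folklore] -/
theorem cuspFormLSeries_sum_smul {N : ℕ} [NeZero N] {k : ℤ} {ι : Type*} (S : Finset ι)
    (g : ι → CuspForm (Gamma0 N) k) (c : ι → ℂ) {s : ℂ} (hs : ((k : ℝ) + 1) / 2 < s.re) :
    cuspFormLSeries (∑ i ∈ S, c i • g i) s = ∑ i ∈ S, c i * cuspFormLSeries (g i) s := by
  have hcoeff : cuspCoeff (∑ i ∈ S, c i • g i) = ∑ i ∈ S, c i • cuspCoeff (g i) := by
    funext n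
    rw [cuspCoeff_sum_smul, Finset.sum_apply]
    simp [Pi.smul_apply, smul_eq_mul]
  rw [cuspFormLSeries, hcoeff, LSeries_sum]
  · refine Finset.sum_congr rfl fun i _ ↦ ?_
    rw [LSeries_smul]
    rfl
  · intro i _
    exact (LSeriesSummable_cuspCoeff_of_lt_re (strictWidthInfty_Gamma0 N) (g i) hs).smul _

/-! ### The Mellin transform on `Re s > (k+1)/2` -/

/-- **`∫_0^∞ f(it) t^{s-1} dt = (2π)^{-s} Γ(s) L(f, s)` for `Re s > (k+1)/2`, `Re s > 0`**
(`f` a cusp form on `Γ₀(N)`): the tree's `heckeContinuation_eq_cuspFormLSeries_of_lt_re`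
(`(2π)^s Γ(s)⁻¹ ∫ = L(f, s)` on Rankin's half-plane) solved for the integral where `Γ(s) ≠ 0`.
[cite: DiamondShurman2005, §5.10 (5.35)] -/
theorem mellin_imagAxis_eq_of_lt_re {N : ℕ} [NeZero N] {k : ℤ} (f : CuspForm (Gamma0 N) k)
    {s : ℂ} (hs : ((k : ℝ) + 1) / 2 < s.re) (hs₀ : 0 < s.re) :
    mellin (fun t : ℝ ↦ f (ofComplex (Complex.I * (t : ℂ)))) s =
      (2 * Real.pi : ℂ) ^ (-s) * Complex.Gamma s * cuspFormLSeries f s := by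
  have h := heckeContinuation_eq_cuspFormLSeries_of_lt_re (strictWidthInfty_Gamma0 N) f hs
  have hΓ : Complex.Gamma s ≠ 0 := Complex.Gamma_ne_zero_of_re_pos hs₀
  have h2π : (2 * Real.pi : ℂ) ≠ 0 := by exact_mod_cast Real.two_pi_pos.ne'
  have h2πs : (2 * Real.pi : ℂ) ^ s ≠ 0 := by
    rw [Ne, Complex.cpow_eq_zero_iff, not_and_or]
    exact Or.inl h2π
  rw [← h, Complex.cpow_neg]
  field_simp

/-- The Mellin transform of `t ↦ f(it)` vanishes at `s` (`Re s > (k+1)/2`, `Re s > 0`) iff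
`L(f, s) = 0`. [cite: BookerThorne2014, §1 (Thm. 1 from Thm. 2)] -/
theorem mellin_imagAxis_eq_zero_iff {N : ℕ} [NeZero N] {k : ℤ} (f : CuspForm (Gamma0 N) k)
    {s : ℂ} (hs : ((k : ℝ) + 1) / 2 < s.re) (hs₀ : 0 < s.re) :
    mellin (fun t : ℝ ↦ f (ofComplex (Complex.I * (t : ℂ)))) s = 0 ↔ cuspFormLSeries f s = 0 := by
  rw [mellin_imagAxis_eq_of_lt_re f hs hs₀]
  have hΓ : Complex.Gamma s ≠ 0 := Complex.Gamma_ne_zero_of_re_pos hs₀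
  have h2πs : (2 * Real.pi : ℂ) ^ (-s) ≠ 0 := by
    rw [Ne, Complex.cpow_eq_zero_iff, not_and_or]
    exact Or.inl (by exact_mod_cast Real.two_pi_pos.ne')
  simp [hΓ, h2πs]

/-! ### Level one -/

/-- A non-zero cusp form of level `SL(2, ℤ)` has weight at least `12` (Mathlib's level-one
dimension formula: `S_k = 0` for `k < 12`). [folklore] -/
theorem twelve_le_weight_of_ne_zero {k : ℤ} {f : CuspForm 𝒮ℒ k} (hf : f ≠ 0) : 12 ≤ k := by
  by_contra hk
  push Not at hk
  exact hf (rank_zero_iff_forall_zero.1 (CuspForm.rank_eq_zero_of_weight_lt_twelve hk) f)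

/-- **`Λ_f(s) = (2π)^{-s} Γ(s) ∑_g c_g L(g, s)`** for a level-one cusp form `f` whose underlying
function is that of the combination `∑_g c_g g` of cusp forms on `Γ₀(1)`, on `Re s > (k+1)/2`,
`Re s > 0`. [cite: BookerThorne2014, §1 (Thm. 1 from Thm. 2)] -/
theorem cuspFormLambda_eq_sum {k : ℤ} (f : CuspForm 𝒮ℒ k) {ι : Type*} {S : Finset ι}
    {g : ι → CuspForm (Gamma0 1) k} {c : ι → ℂ} (hf : (⇑(∑ i ∈ S, c i • g i) : ℍ → ℂ) = ⇑f)
    {s : ℂ} (hs : ((k : ℝ) + 1) / 2 < s.re) (hs₀ : 0 < s.re) :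
    cuspFormLambda f s =
      (2 * Real.pi : ℂ) ^ (-s) * Complex.Gamma s * ∑ i ∈ S, c i * cuspFormLSeries (g i) s := by
  rw [← cuspFormLSeries_sum_smul S g c hs, ← mellin_imagAxis_eq_of_lt_re _ hs hs₀, cuspFormLambda,
    hf]

/-- **Zeros of `Λ_f` are zeros of `∑_g c_g L(g, ·)`** on `Re s > (k+1)/2`, `Re s > 0`.
[cite: BookerThorne2014, §1 (Thm. 1 from Thm. 2)] -/
theorem cuspFormLambda_eq_zero_iff_sum {k : ℤ} (f : CuspForm 𝒮ℒ k) {ι : Type*} {S : Finset ι}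
    {g : ι → CuspForm (Gamma0 1) k} {c : ι → ℂ} (hf : (⇑(∑ i ∈ S, c i • g i) : ℍ → ℂ) = ⇑f)
    {s : ℂ} (hs : ((k : ℝ) + 1) / 2 < s.re) (hs₀ : 0 < s.re) :
    cuspFormLambda f s = 0 ↔ ∑ i ∈ S, c i * cuspFormLSeries (g i) s = 0 := by
  rw [← cuspFormLSeries_sum_smul S g c hs, ← mellin_imagAxis_eq_zero_iff _ hs hs₀, cuspFormLambda,
    hf]

/-- **The counting conclusion of `BookerThorne2014_levelOne_zeros` from `HasLinearlyManyZeros`.**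
If `⇑(∑_g c_g g) = ⇑f` (`f` of level one and weight `k ≥ 0`) and the Dirichlet series
`∑_g c_g L(g, ·)` has `≫ T` distinct zeros in the open strip `σ₁ < Re s < σ₂` with
`(k+1)/2 < σ₁`, then `Λ_f` has `≫ T` distinct zeros with `σ₁ ≤ Re s ≤ σ₂`, `|Im s| ≤ T`.
[cite: BookerThorne2014, §1, Remark 2 and Thm. 1] -/
theorem levelOne_zeros_of_hasLinearlyManyZeros {k : ℤ} (hk : 0 ≤ k) (f : CuspForm 𝒮ℒ k)
    {ι : Type*} {S : Finset ι} {g : ι → CuspForm (Gamma0 1) k} {c : ι → ℂ}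
    (hf : (⇑(∑ i ∈ S, c i • g i) : ℍ → ℂ) = ⇑f) {σ₁ σ₂ : ℝ} (hσ₁ : ((k : ℝ) + 1) / 2 < σ₁)
    (h : HasLinearlyManyZeros (fun s ↦ ∑ i ∈ S, c i * cuspFormLSeries (g i) s) σ₁ σ₂) :
    ∃ c : ℝ, 0 < c ∧ ∃ T₀ : ℝ, ∀ T : ℝ, T₀ ≤ T →
      ∃ Z : Finset ℂ, c * T ≤ Z.card ∧ ∀ s ∈ Z,
        σ₁ ≤ s.re ∧ s.re ≤ σ₂ ∧ |s.im| ≤ T ∧ cuspFormLambda f s = 0 := by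
  obtain ⟨c₀, hc₀, T₀, hT⟩ := h
  refine ⟨c₀, hc₀, T₀, fun T hTT ↦ ?_⟩
  obtain ⟨Z, hZ, hmem⟩ := hT T hTT
  refine ⟨Z, hZ, fun s hs ↦ ?_⟩
  obtain ⟨h₁, h₂, h₃, h₄⟩ := hmem s hs
  have hk' : (0 : ℝ) ≤ k := by exact_mod_cast hk
  have hsre : ((k : ℝ) + 1) / 2 < s.re := lt_trans hσ₁ h₁
  have hs₀ : 0 < s.re := by linarith
  exact ⟨h₁.le, h₂.le, h₃, (cuspFormLambda_eq_zero_iff_sum f hf hsre hs₀).2 h₄⟩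

end Literature.Barriers.RiemannHypothesis
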